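import Literature.IUT.HodgeArakelov.BadPrimeGaussianMonoidsProofs2

/-!
# [IUTchII] Def 2.3 (v): the kernel of the label action on `LabCusp^±(Π̂^±_v)` is EXACTLY `Π̂^±_v`

S. Mochizuki, *Inter-universal Teichmüller theory II*, kurims manuscript (Dec. 2020), §2 Def 2.3 (v) p. 69: «the
natural action of `Π_⊇/Π_⊆` on `Π_⊆` preserves this `𝔽^±_l`-torsor structure, hence determines a natural outer
isomorphism `Π_⊇/Π_⊆ ≅ 𝔽_l^{⋊±}`» (`Π_⊆ = Π̂^±_v`, `Π_⊇ = Π̂^cor_v`) [claim: Mochizuki2012, status: disputed]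
(IUTchII §2 Def 2.3 (v), kurims p.69) (D-0012 claim key; nothing printed is asserted here).

PROOF-ONLY file (abc-iut cell, seat abc-iut-w5-d243 gen 3; no `def`, no instance, no named fact), INTERFACE LEVEL —
over EVERY `(S, T, W, C)` and every inhabitant `F : FlTorsorStructure C` of abc-iut-L6-t1's interface
(`LabelClassesOfCusps.lean`): **`FlTorsorStructure.forall_conjAct_eq_self_iff`** — an element `g ∈ Π̂^cor_v` fixes EVERY
label class of `LabCusp^±(Π̂^±_v)` under `F.conjAct` IFF `g ∈ Π̂^±_v`.  (`⇐` is abc-iut-w4-d004's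
`BadPrimeGaussianMonoids.conjAct_eq_self_of_mem_pmHat` — [IUTchII] Cor 3.5 (i) — imported BY NAME; `⇒`: through the
chart `g` acts by the affine map `x ↦ ε x + a`, `(a, ε) = quotIso ḡ ∈ 𝔽_l ⋊ {±1}`, and for the ODD PRIME `l = S.l` an
affine map of `𝔽_l` fixing every point is the identity — `ε = −1` would force `2 = 0` in `𝔽_l`.)  So the typed chart
law `conjAct_chart` alone makes the induced action of `Π̂^cor_v/Π̂^±_v ≅ 𝔽_l^{⋊±}` on labels FAITHFUL — the kernel-level
content of «determines a natural outer isomorphism».  Consumer: the typing probe `FlTorsorConjActKernel.lean`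
(GAP-LEDGER G-w5d243-1).  Nothing here bears on [IUTchIII] Cor. 3.12; typed ≠ proved; no side taken.
-/

noncomputable section

namespace Literature.IUT.HodgeArakelov

universe u

/-! ## (A) The kernel of the label action is `Π̂^±_v` -/

namespace FlTorsorStructure

open Literature.IUT.HodgeTheaters

variable {S : BadPlaceSetting.{u}} {P : TopGroup.{u}} {T : TemperedCoverings S P} {W : PlusMinusTower T}
  {C : CuspidalInertiaData W} (F : FlTorsorStructure C)

/-- In `𝔽_l` for the setting's odd prime `l`, `−1 ≠ 1`. [claim: Mochizuki2012, status: disputed] (IUTchII §2 Def 2.3 (v), kurims p.69) -/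
theorem neg_one_ne_one : (-1 : ZMod S.l) ≠ 1 := by
  intro h
  have h2 : ((2 : ℕ) : ZMod S.l) = 0 := by
    rw [Nat.cast_ofNat]
    calc (2 : ZMod S.l) = 1 + 1 := one_add_one_eq_two.symm
      _ = -1 + 1 := by rw [h]
      _ = 0 := neg_add_cancel 1
  rw [ZMod.natCast_eq_zero_iff] at h2
  exact S.l_odd (le_antisymm (Nat.le_of_dvd two_pos h2) S.l_prime.two_le)

/-- **IUTchII:Def2.3(v)** (kurims p. 69) — through the chart, `g` acts on `LabCusp^±(Π̂^±_v)` by the affine map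
`x ↦ ε x + a` with `(a, ε) = quotIso ḡ`; if this map fixes every point of `𝔽_l` then `(a, ε) = (0, 1)`.
[claim: Mochizuki2012, status: disputed] (IUTchII §2 Def 2.3 (v), kurims p.69) -/
theorem quotIso_eq_one_of_forall_conjAct_eq_self {g : W.Corhat} (h : ∀ t, F.conjAct g t = t) :
    F.quotIso (QuotientGroup.mk g) = 1 := by
  set x := F.quotIso (QuotientGroup.mk g) with hx
  have key : ∀ z : ZMod S.l, Multiplicative.toAdd x.left + ((x.right : ℤ) : ZMod S.l) * z = z := by
    intro z
    have e := congrArg F.chart (h (F.chart.symm z))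
    rw [F.conjAct_chart, Equiv.apply_symm_apply] at e
    exact_mod_cast e
  have h0 : Multiplicative.toAdd x.left = 0 := by simpa using key 0
  have h1 : ((x.right : ℤ) : ZMod S.l) = 1 := by simpa [h0] using key 1
  have hε : x.right = 1 := by
    rcases Int.units_eq_one_or x.right with e | e
    · exact e
    · exfalso
      rw [e, Units.val_neg, Units.val_one, Int.cast_neg, Int.cast_one] at h1
      exact neg_one_ne_one h1
  refine SemidirectProduct.ext ?_ hε
  rw [SemidirectProduct.one_left]
  exact toAdd_eq_zero.mp h0

/-- **IUTchII:Def2.3(v)** (kurims p. 69) — **the kernel of the label action is exactly `Π̂^±_v`**: `g ∈ Π̂^cor_v`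
fixes every `±`-label class of `Π̂^±_v` under `F.conjAct` iff `g ∈ Π̂^±_v` (so the induced action of
`Π̂^cor_v/Π̂^±_v ≅ 𝔽_l^{⋊±}` on labels is faithful). `⇐` is abc-iut-w4-d004's
`BadPrimeGaussianMonoids.conjAct_eq_self_of_mem_pmHat`. [claim: Mochizuki2012, status: disputed] (IUTchII §2 Def 2.3 (v), kurims p.69) -/
theorem forall_conjAct_eq_self_iff (g : W.Corhat) : (∀ t, F.conjAct g t = t) ↔ g ∈ W.pmHat := by
  refine ⟨fun h => ?_, fun hg t => BadPrimeGaussianMonoids.conjAct_eq_self_of_mem_pmHat F hg t⟩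
  rw [← QuotientGroup.eq_one_iff, ← F.quotIso.map_eq_one_iff]
  exact F.quotIso_eq_one_of_forall_conjAct_eq_self h

/-- **IUTchII:Def2.3(v)** (kurims p. 69) — contrapositive: an element OUTSIDE `Π̂^±_v` moves some label class.
[claim: Mochizuki2012, status: disputed] (IUTchII §2 Def 2.3 (v), kurims p.69) -/
theorem exists_conjAct_ne_self {g : W.Corhat} (hg : g ∉ W.pmHat) : ∃ t, F.conjAct g t ≠ t :=
  not_forall.mp fun h => hg ((F.forall_conjAct_eq_self_iff g).mp h)

end FlTorsorStructure

end Literature.IUT.HodgeArakelov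

end
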